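import Summits.KontsevichZagierPeriods.Zeta5Search.Barrier.ConeGammaCuspSlopeLexLocal

/-!
# ζ(5) search — BARRIER: THE KINK CRITERION AT A SIMPLE TIE — `σ` (anywhere) and `P` (inside the rate ball) are differentiable at a
# displacement with one tie IFF the pooled wall defect vanishes (file (7), sequel of «THE LEXICOGRAPHIC GERM»)

HONEST FRAMING (cell `pub-zeta5`): systematic search; no irrationality claim unless kernel-certified. MODEL objects
under Brown–Zudilin's (28)+(30) accounting ([BZ22] = arXiv:2210.03391; (28) observed, not proved); nothing here is a
statement about `ζ(5)`, any `γ` of record, the cone's supremum (C2 OPEN) or the value / sign of a wall defect at a named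
direction (DATA of the cell — whether a given wall kinks `σ` or `P` at a given direction is decided by data this file does not
contain);
NO cancellation is quantified; S-E / (TD_A) stay CONJECTURED; records in print UNMOVED. Prover P2 g42 (SEQUEL of «THE
LEXICOGRAPHIC GERM», file (7); plan INBOX 2026-08-28). Sources: files (1)–(6) of the item, P2 g30 `ConeGammaCuspChamberCover`
(`exists_rate_sub_ne_zero`), Mathlib's one-sided slope lemma `HasDerivAt.tendsto_slope_zero_right`.

SETTING. `a` with all 28 forms positive, `T > 0` a period, `σ = cuspSlope a T`, `F` the canonical period pattern function;
`δ` with a SIMPLE TIE at `{k₁, k₂}` (the only coincidence of rates), `S = {j : r_{k₁}(δ) < r_j(δ)}`,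
`m_F = F(S∪{k₁}) + F(S∪{k₂}) − F(S) − F(S∪{k₁,k₂})` the pooled wall defect.
* **`not_differentiableAt_of_kink`** — calculus: a function on `ℝ⁸` whose symmetric second difference at `δ` along some `Δ` is
  EXACTLY `t·κ` on `(0, t₀]` with `κ ≠ 0` is NOT differentiable at `δ` (a derivative forces the symmetric second difference to be
  `o(t)`: the right slope of `t ↦ f(δ+tΔ) + f(δ−tΔ)` at `0` is `L(Δ) + L(−Δ) = 0`);
* **`not_differentiableAt_cuspSlope_of_defect_ne_zero`** — at a simple tie with `m_F ≠ 0`, `σ` is NOT differentiable at `δ`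
  (file (2): the kink along a splitting `Δ` is `t·m_F·(r_{k₂}Δ − r_{k₁}Δ) ≠ 0`; a splitting direction exists by g30);
* `eventually_refines_nhds` (near `δ` every strict rate inequality of `δ` persists), **`cuspSlope_eq_greedy_near_of_defect_eq_zero`**
  — at a simple tie with `m_F = 0`, for ANY generic `δ₀` refining `δ` with `ρ₀_{k₁} < ρ₀_{k₂}`, `σ(δ') = Σ_k W_k(δ₀)·r_k(δ')` on a whole
  NEIGHBOURHOOD of `δ` (a nearby `δ'` is refined by `δ₀` or by the reversed reference, and the two functionals coincide when
  `m_F = 0` — file (2)'s `lex_functional_sub_of_simple_tie` with `Δ = δ₀`: every generic refinement of `δ` is a lexicographic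
  reference of the pair `(δ, δ₀)`);
* **`differentiableAt_cuspSlope_iff_defect_eq_zero` — THE KINK CRITERION**: at a simple tie, **`σ` is differentiable at `δ` iff
  `m_F = 0`**;
* **`not_differentiableAt_translateIntegral_of_defect_ne_zero`**, **`differentiableAt_translateIntegral_iff_defect_eq_zero`** — the
  same for the translate integral `P` at a translate of the OPEN rate ball with a simple tie (file (3): `P = P(0) + σ` there): **`P`
  is differentiable at `δ` iff `m_F = 0`** — inside the ball the rate walls that ACTUALLY kink `P` at their generic points are
  exactly those with a non-zero pooled defect (`|m_F| ≤ J_{kl}`, file (4); which walls these are at a named direction is DATA).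
NOT here (honest): the value of any `m_F` (DATA); multiple ties (file (5) gives the bound, not a criterion); beyond the ball
((TD_A) CONJECTURED); `Φ`, `γ`, C2, S-E's truth, `ζ(5)`.
-/

noncomputable section

open Set Finset Filter
open scoped Topology

namespace Summit.KontsevichZagierPeriods.Zeta5Search.Barrier.ConeGamma

/-! ### A linear kink obstructs differentiability -/

/-- **A LINEAR KINK OBSTRUCTS DIFFERENTIABILITY.** If `f(δ + t·Δ) + f(δ − t·Δ) − 2f(δ) = t·κ` for all `t ∈ [0, t₀]` (`t₀ > 0`) with
`κ ≠ 0`, then `f` is not (Fréchet-)differentiable at `δ`. -/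
theorem not_differentiableAt_of_kink {f : (Fin 8 → ℝ) → ℝ} {δ Δ : Fin 8 → ℝ} {κ t₀ : ℝ} (ht₀ : 0 < t₀) (hκ : κ ≠ 0)
    (h : ∀ t ∈ Icc (0 : ℝ) t₀, f (δ + t • Δ) + f (δ - t • Δ) - 2 * f δ = t * κ) :
    ¬DifferentiableAt ℝ f δ := by
  intro hd
  set L := fderiv ℝ f δ with hL
  -- one-dimensional derivatives along `±Δ`
  have hder : ∀ Δ' : Fin 8 → ℝ, HasDerivAt (fun t : ℝ => f (δ + t • Δ')) (L Δ') 0 := fun Δ' => by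
    have hF : HasFDerivAt f L (δ + (0 : ℝ) • Δ') := by rw [zero_smul, add_zero]; exact hd.hasFDerivAt
    have hline : HasDerivAt (fun t : ℝ => δ + t • Δ') Δ' 0 := by
      simpa using ((hasDerivAt_id (0 : ℝ)).smul_const Δ').const_add δ
    exact hF.comp_hasDerivAt (0 : ℝ) hline
  have hsum : HasDerivAt (fun t : ℝ => f (δ + t • Δ) + f (δ - t • Δ)) 0 0 := by
    have h1 := (hder Δ).add (hder (-Δ))
    rw [map_neg, add_neg_cancel] at h1
    refine h1.congr_of_eventuallyEq (Filter.Eventually.of_forall fun t => ?_)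
    simp only [smul_neg, sub_eq_add_neg, Pi.add_apply]
  -- the right slope at `0` tends to `0`, but equals `κ` on `(0, t₀]`
  have hslope := hsum.tendsto_slope_zero_right
  have hev : (fun t : ℝ => t⁻¹ • ((f (δ + (0 + t) • Δ) + f (δ - (0 + t) • Δ)) -
      (f (δ + (0 : ℝ) • Δ) + f (δ - (0 : ℝ) • Δ)))) =ᶠ[𝓝[>] (0 : ℝ)] fun _ => κ := by
    filter_upwards [Ioc_mem_nhdsGT ht₀] with t ht
    have e := h t ⟨ht.1.le, ht.2⟩
    rw [zero_add, zero_smul, add_zero, sub_zero, smul_eq_mul,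
      show f (δ + t • Δ) + f (δ - t • Δ) - (f δ + f δ) = t * κ by linarith, ← mul_assoc, inv_mul_cancel₀ ht.1.ne',
      one_mul]
  have hκ0 : κ = 0 := tendsto_nhds_unique (tendsto_const_nhds.congr' hev.symm) hslope
  exact hκ hκ0

/-! ### A non-zero pooled defect kinks `σ` -/

/-- **A splitting direction exists** for any two distinct forms: some `Δ` has `r_{k₁}(Δ) < r_{k₂}(Δ)`. -/
theorem exists_split {a : Dir} (hpos : ∀ k, 0 < h28 a k) {k₁ k₂ : Fin 28} (hne : k₁ ≠ k₂) :
    ∃ Δ : Fin 8 → ℝ, phiForm Δ k₁ / h28 a k₁ < phiForm Δ k₂ / h28 a k₂ := by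
  obtain ⟨v, hv⟩ := exists_rate_sub_ne_zero hpos hne
  rcases hv.lt_or_gt with h | h
  · exact ⟨v, by linarith⟩
  · refine ⟨-v, ?_⟩
    rw [phiForm_neg, phiForm_neg, neg_div, neg_div]
    linarith

open scoped Classical in
/-- **A NON-ZERO POOLED WALL DEFECT KINKS `σ`.** All 28 forms of `a` positive, `T > 0` a period, `F` the canonical period pattern
function; `δ` with a simple tie at `{k₁, k₂}` and `m_F(S; k₁, k₂) ≠ 0`, `S = {j : r_{k₁}(δ) < r_j(δ)}`. Then `σ` is NOT differentiable
at `δ`. -/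
theorem not_differentiableAt_cuspSlope_of_defect_ne_zero {a : Dir} (hpos : ∀ k, 0 < h28 a k) {T : ℝ} (hT : 0 < T)
    (hper : ∀ k : Fin 28, ∃ z : ℤ, T * h28 a k = z) {F : Finset (Fin 28) → ℝ}
    (hF : ∀ A, F A = ∑ m ∈ Finset.range ((bkpts a T).card - 1), ((patternN a (bkpt a T m) A : ℤ) : ℝ))
    {δ : Fin 8 → ℝ} {k₁ k₂ : Fin 28} (hne : k₁ ≠ k₂) (htie : phiForm δ k₁ / h28 a k₁ = phiForm δ k₂ / h28 a k₂)
    (hsimple : ∀ i j : Fin 28, i ≠ j → phiForm δ i / h28 a i = phiForm δ j / h28 a j →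
      (i = k₁ ∧ j = k₂) ∨ (i = k₂ ∧ j = k₁))
    (hm : F (insert k₁ (Finset.univ.filter fun j => phiForm δ k₁ / h28 a k₁ < phiForm δ j / h28 a j)) +
        F (insert k₂ (Finset.univ.filter fun j => phiForm δ k₁ / h28 a k₁ < phiForm δ j / h28 a j)) -
        F (Finset.univ.filter fun j => phiForm δ k₁ / h28 a k₁ < phiForm δ j / h28 a j) -
        F (insert k₁ (insert k₂ (Finset.univ.filter fun j => phiForm δ k₁ / h28 a k₁ < phiForm δ j / h28 a j))) ≠ 0) :
    ¬DifferentiableAt ℝ (cuspSlope a T) δ := by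
  obtain ⟨Δ, hsplit⟩ := exists_split hpos hne
  obtain ⟨m, hmF, -, t₀, ht₀, h⟩ := cuspSlope_kink_of_simple_tie hpos hT hper hF δ Δ hne htie hsimple hsplit
  refine not_differentiableAt_of_kink (κ := (m : ℝ) * (phiForm Δ k₂ / h28 a k₂ - phiForm Δ k₁ / h28 a k₁)) ht₀
    (mul_ne_zero (by rw [hmF]; exact hm) (by linarith)) h

/-! ### A vanishing pooled defect: `σ` is one chamber functional near the tie -/

/-- **Near `δ` every strict rate inequality of `δ` persists.** -/
theorem eventually_refines_nhds (a : Dir) (δ : Fin 8 → ℝ) :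
    ∀ᶠ δ' in 𝓝 δ, ∀ k l : Fin 28, phiForm δ k / h28 a k < phiForm δ l / h28 a l →
      phiForm δ' k / h28 a k < phiForm δ' l / h28 a l := by
  have hc : ∀ k, Continuous fun θ : Fin 8 → ℝ => phiForm θ k / h28 a k := fun k =>
    (continuous_phiForm k).div_const _
  rw [Filter.eventually_all]
  intro k
  rw [Filter.eventually_all]
  intro l
  by_cases hkl : phiForm δ k / h28 a k < phiForm δ l / h28 a l
  · filter_upwards [((hc k).continuousAt).eventually_lt ((hc l).continuousAt) hkl] with δ' h _
    exact h
  · exact Filter.Eventually.of_forall fun _ h => absurd h hkl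

open scoped Classical in
/-- **A VANISHING POOLED DEFECT: `σ` IS ONE CHAMBER FUNCTIONAL NEAR THE TIE.** All 28 forms of `a` positive, `T > 0` a period, `F`
the canonical period pattern function; `δ` with a simple tie at `{k₁, k₂}` and `m_F(S; k₁, k₂) = 0`; `δ₀` ANY generic reference
refining `δ` with `ρ₀_{k₁} < ρ₀_{k₂}`. Then `σ(δ') = Σ_k W_k(δ₀)·r_k(δ')` for all `δ'` in a neighbourhood of `δ`. -/
theorem cuspSlope_eq_greedy_near_of_defect_eq_zero {a : Dir} (hpos : ∀ k, 0 < h28 a k) {T : ℝ} (hT : 0 < T)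
    (hper : ∀ k : Fin 28, ∃ z : ℤ, T * h28 a k = z) {F : Finset (Fin 28) → ℝ}
    (hF : ∀ A, F A = ∑ m ∈ Finset.range ((bkpts a T).card - 1), ((patternN a (bkpt a T m) A : ℤ) : ℝ))
    {δ : Fin 8 → ℝ} {k₁ k₂ : Fin 28} (hne : k₁ ≠ k₂) (htie : phiForm δ k₁ / h28 a k₁ = phiForm δ k₂ / h28 a k₂)
    (hsimple : ∀ i j : Fin 28, i ≠ j → phiForm δ i / h28 a i = phiForm δ j / h28 a j →
      (i = k₁ ∧ j = k₂) ∨ (i = k₂ ∧ j = k₁))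
    (hm : F (insert k₁ (Finset.univ.filter fun j => phiForm δ k₁ / h28 a k₁ < phiForm δ j / h28 a j)) +
        F (insert k₂ (Finset.univ.filter fun j => phiForm δ k₁ / h28 a k₁ < phiForm δ j / h28 a j)) -
        F (Finset.univ.filter fun j => phiForm δ k₁ / h28 a k₁ < phiForm δ j / h28 a j) -
        F (insert k₁ (insert k₂ (Finset.univ.filter fun j => phiForm δ k₁ / h28 a k₁ < phiForm δ j / h28 a j))) = 0)
    {δ₀ : Fin 8 → ℝ} (hgen : ∀ k l : Fin 28, k ≠ l → phiForm δ₀ k / h28 a k ≠ phiForm δ₀ l / h28 a l)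
    (href : ∀ k l : Fin 28, phiForm δ k / h28 a k < phiForm δ l / h28 a l →
      phiForm δ₀ k / h28 a k < phiForm δ₀ l / h28 a l)
    (h12 : phiForm δ₀ k₁ / h28 a k₁ < phiForm δ₀ k₂ / h28 a k₂) :
    ∀ᶠ δ' in 𝓝 δ, cuspSlope a T δ' =
      ∑ k, (F (Finset.univ.filter fun l => phiForm δ₀ k / h28 a k ≤ phiForm δ₀ l / h28 a l) -
          F (Finset.univ.filter fun l => phiForm δ₀ k / h28 a k < phiForm δ₀ l / h28 a l)) *
        (phiForm δ' k / h28 a k) := by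
  -- `δ₀` is a lexicographic reference of `(δ, δ₀)`; the reversed reference `δ₀'`
  have hlex : ∀ k l : Fin 28, (phiForm δ k / h28 a k < phiForm δ l / h28 a l ∨
      (phiForm δ k / h28 a k = phiForm δ l / h28 a l ∧ phiForm δ₀ k / h28 a k < phiForm δ₀ l / h28 a l)) →
        phiForm δ₀ k / h28 a k < phiForm δ₀ l / h28 a l := fun k l h => h.elim (href k l) And.right
  obtain ⟨δ₀', hgen', hlex₀⟩ := exists_generic_refines_lex hpos δ (-δ₀)
  have hneg : ∀ k, phiForm (-δ₀) k / h28 a k = -(phiForm δ₀ k / h28 a k) := fun k => by rw [phiForm_neg, neg_div]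
  have hlex' : ∀ k l : Fin 28, (phiForm δ k / h28 a k < phiForm δ l / h28 a l ∨
      (phiForm δ k / h28 a k = phiForm δ l / h28 a l ∧ phiForm δ₀ l / h28 a l < phiForm δ₀ k / h28 a k)) →
        phiForm δ₀' k / h28 a k < phiForm δ₀' l / h28 a l := by
    intro k l h
    refine hlex₀ k l (h.imp_right fun h' => ⟨h'.1, ?_⟩)
    rw [hneg, hneg, neg_lt_neg_iff]
    exact h'.2
  have href' : ∀ k l : Fin 28, phiForm δ k / h28 a k < phiForm δ l / h28 a l →
      phiForm δ₀' k / h28 a k < phiForm δ₀' l / h28 a l := fun k l h => hlex' k l (Or.inl h)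
  have h21' : phiForm δ₀' k₂ / h28 a k₂ < phiForm δ₀' k₁ / h28 a k₁ := hlex' k₂ k₁ (Or.inr ⟨htie.symm, h12⟩)
  -- the two functionals coincide (`m_F = 0`)
  have hfun : ∀ x : Fin 28 → ℝ,
      ∑ k, (F (Finset.univ.filter fun l => phiForm δ₀' k / h28 a k ≤ phiForm δ₀' l / h28 a l) -
          F (Finset.univ.filter fun l => phiForm δ₀' k / h28 a k < phiForm δ₀' l / h28 a l)) * x k =
        ∑ k, (F (Finset.univ.filter fun l => phiForm δ₀ k / h28 a k ≤ phiForm δ₀ l / h28 a l) -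
          F (Finset.univ.filter fun l => phiForm δ₀ k / h28 a k < phiForm δ₀ l / h28 a l)) * x k := fun x => by
    have hd := lex_functional_sub_of_simple_tie F δ δ₀ hne htie hsimple h12 hgen hgen' hlex hlex' x
    rw [hm, zero_mul] at hd
    have e : ∑ k, ((F (Finset.univ.filter fun l => phiForm δ₀ k / h28 a k ≤ phiForm δ₀ l / h28 a l) -
          F (Finset.univ.filter fun l => phiForm δ₀ k / h28 a k < phiForm δ₀ l / h28 a l)) -
        (F (Finset.univ.filter fun l => phiForm δ₀' k / h28 a k ≤ phiForm δ₀' l / h28 a l) -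
          F (Finset.univ.filter fun l => phiForm δ₀' k / h28 a k < phiForm δ₀' l / h28 a l))) * x k =
      ∑ k, (F (Finset.univ.filter fun l => phiForm δ₀ k / h28 a k ≤ phiForm δ₀ l / h28 a l) -
          F (Finset.univ.filter fun l => phiForm δ₀ k / h28 a k < phiForm δ₀ l / h28 a l)) * x k -
        ∑ k, (F (Finset.univ.filter fun l => phiForm δ₀' k / h28 a k ≤ phiForm δ₀' l / h28 a l) -
          F (Finset.univ.filter fun l => phiForm δ₀' k / h28 a k < phiForm δ₀' l / h28 a l)) * x k := by
      rw [← Finset.sum_sub_distrib]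
      exact Finset.sum_congr rfl fun k _ => by ring
    linarith
  -- off the pair, `δ` decides
  have hoff : ∀ i j, ¬((i = k₁ ∧ j = k₂) ∨ (i = k₂ ∧ j = k₁)) → i ≠ j →
      phiForm δ i / h28 a i ≠ phiForm δ j / h28 a j := fun i j hij hne' h => hij (hsimple i j hne' h)
  filter_upwards [eventually_refines_nhds a δ] with δ' hδ'
  -- a strict inequality of `δ'` off the pair is one of `δ`
  have hstrict : ∀ i j, ¬((i = k₁ ∧ j = k₂) ∨ (i = k₂ ∧ j = k₁)) →
      phiForm δ' i / h28 a i < phiForm δ' j / h28 a j → phiForm δ i / h28 a i < phiForm δ j / h28 a j := by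
    intro i j hij h
    by_cases hij' : i = j
    · subst hij'; exact absurd h (lt_irrefl _)
    rcases (hoff i j hij hij').lt_or_gt with h' | h'
    · exact h'
    · exact absurd ((hδ' j i h').trans h) (lt_irrefl _)
  rcases lt_trichotomy (phiForm δ' k₁ / h28 a k₁) (phiForm δ' k₂ / h28 a k₂) with hp | hp | hp
  · -- refined by `δ₀`
    refine cuspSlope_eq_greedy_canonical_of_refines hpos hT hper hF hgen δ' fun i j h => ?_
    by_cases hij : (i = k₁ ∧ j = k₂) ∨ (i = k₂ ∧ j = k₁)
    · rcases hij with ⟨rfl, rfl⟩ | ⟨rfl, rfl⟩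
      · exact h12
      · exact absurd (hp.trans h) (lt_irrefl _)
    · exact href i j (hstrict i j hij h)
  · -- a tie at `δ'` too: refined by `δ₀`
    refine cuspSlope_eq_greedy_canonical_of_refines hpos hT hper hF hgen δ' fun i j h => ?_
    by_cases hij : (i = k₁ ∧ j = k₂) ∨ (i = k₂ ∧ j = k₁)
    · rcases hij with ⟨rfl, rfl⟩ | ⟨rfl, rfl⟩
      · exact h12
      · exact absurd (hp ▸ h) (lt_irrefl _)
    · exact href i j (hstrict i j hij h)
  · -- refined by the reversed reference `δ₀'`, whose functional is the same
    rw [← hfun]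
    refine cuspSlope_eq_greedy_canonical_of_refines hpos hT hper hF hgen' δ' fun i j h => ?_
    by_cases hij : (i = k₁ ∧ j = k₂) ∨ (i = k₂ ∧ j = k₁)
    · rcases hij with ⟨rfl, rfl⟩ | ⟨rfl, rfl⟩
      · exact absurd (hp.trans h) (lt_irrefl _)
      · exact h21'
    · exact href' i j (hstrict i j hij h)

/-! ### THE KINK CRITERION -/

open scoped Classical in
/-- **THE KINK CRITERION AT A SIMPLE TIE.** All 28 forms of `a` positive, `T > 0` a period, `F` the canonical period pattern
function; `δ` with a simple tie at `{k₁, k₂}`. Then **`σ` is differentiable at `δ` iff the pooled wall defect `m_F(S; k₁, k₂)`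
vanishes** (`S = {j : r_{k₁}(δ) < r_j(δ)}`). -/
theorem differentiableAt_cuspSlope_iff_defect_eq_zero {a : Dir} (hpos : ∀ k, 0 < h28 a k) {T : ℝ} (hT : 0 < T)
    (hper : ∀ k : Fin 28, ∃ z : ℤ, T * h28 a k = z) {F : Finset (Fin 28) → ℝ}
    (hF : ∀ A, F A = ∑ m ∈ Finset.range ((bkpts a T).card - 1), ((patternN a (bkpt a T m) A : ℤ) : ℝ))
    {δ : Fin 8 → ℝ} {k₁ k₂ : Fin 28} (hne : k₁ ≠ k₂) (htie : phiForm δ k₁ / h28 a k₁ = phiForm δ k₂ / h28 a k₂)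
    (hsimple : ∀ i j : Fin 28, i ≠ j → phiForm δ i / h28 a i = phiForm δ j / h28 a j →
      (i = k₁ ∧ j = k₂) ∨ (i = k₂ ∧ j = k₁)) :
    DifferentiableAt ℝ (cuspSlope a T) δ ↔
      F (insert k₁ (Finset.univ.filter fun j => phiForm δ k₁ / h28 a k₁ < phiForm δ j / h28 a j)) +
        F (insert k₂ (Finset.univ.filter fun j => phiForm δ k₁ / h28 a k₁ < phiForm δ j / h28 a j)) -
        F (Finset.univ.filter fun j => phiForm δ k₁ / h28 a k₁ < phiForm δ j / h28 a j) -
        F (insert k₁ (insert k₂ (Finset.univ.filter fun j => phiForm δ k₁ / h28 a k₁ < phiForm δ j / h28 a j))) = 0 := by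
  constructor
  · intro hd
    by_contra hm
    exact not_differentiableAt_cuspSlope_of_defect_ne_zero hpos hT hper hF hne htie hsimple hm hd
  · intro hm
    -- a generic reference refining `δ` with `k₁` first
    obtain ⟨Δ, hsplit⟩ := exists_split hpos hne
    obtain ⟨δ₀, hgen, hlex⟩ := exists_generic_refines_lex hpos δ Δ
    have href : ∀ k l : Fin 28, phiForm δ k / h28 a k < phiForm δ l / h28 a l →
        phiForm δ₀ k / h28 a k < phiForm δ₀ l / h28 a l := fun k l h => hlex k l (Or.inl h)
    have h12 : phiForm δ₀ k₁ / h28 a k₁ < phiForm δ₀ k₂ / h28 a k₂ := hlex k₁ k₂ (Or.inr ⟨htie, hsplit⟩)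
    have hnear := cuspSlope_eq_greedy_near_of_defect_eq_zero hpos hT hper hF hne htie hsimple hm hgen href h12
    -- the chamber functional as a continuous linear map
    set W : Fin 28 → ℝ := fun k => F (Finset.univ.filter fun l => phiForm δ₀ k / h28 a k ≤ phiForm δ₀ l / h28 a l) -
        F (Finset.univ.filter fun l => phiForm δ₀ k / h28 a k < phiForm δ₀ l / h28 a l) with hW
    let Lₗ : (Fin 8 → ℝ) →ₗ[ℝ] ℝ :=
      { toFun := fun Δ => ∑ k, W k * (phiForm Δ k / h28 a k)
        map_add' := fun Δ Δ' => by
          rw [← Finset.sum_add_distrib]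
          exact Finset.sum_congr rfl fun k _ => by rw [phiForm_add]; ring
        map_smul' := fun c Δ => by
          rw [RingHom.id_apply, smul_eq_mul, Finset.mul_sum]
          exact Finset.sum_congr rfl fun k _ => by rw [phiForm_smul]; ring }
    set L : (Fin 8 → ℝ) →L[ℝ] ℝ := LinearMap.toContinuousLinearMap Lₗ with hL
    have hLapply : ∀ Δ, L Δ = ∑ k, W k * (phiForm Δ k / h28 a k) := fun Δ => rfl
    have heq : (fun δ' => L δ') =ᶠ[𝓝 δ] cuspSlope a T := by
      filter_upwards [hnear] with δ' h
      rw [hLapply, h]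
    exact (L.hasFDerivAt.congr_of_eventuallyEq heq.symm).differentiableAt

/-! ### Transfer to the translate integral inside the rate ball -/

open scoped Classical in
/-- **A NON-ZERO POOLED DEFECT KINKS `P` INSIDE THE BALL.** All 28 forms of `a` positive, `T > 0` a period, `F` the canonical
period pattern function; `δ` a translate of the OPEN rate ball (`|r_k(δ)| < ρ̄`, `2ρ̄·T·x_max² < 1`, `2ρ̄·x_max < 1`,
`2ρ̄·x_max < wallDist a T`) with a simple tie at `{k₁, k₂}` and `m_F(S; k₁, k₂) ≠ 0`. Then `P` is NOT differentiable at `δ`. -/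
theorem not_differentiableAt_translateIntegral_of_defect_ne_zero {a : Dir} (hpos : ∀ k, 0 < h28 a k) {T : ℝ} (hT : 0 < T)
    (hper : ∀ k : Fin 28, ∃ z : ℤ, T * h28 a k = z) {F : Finset (Fin 28) → ℝ}
    (hF : ∀ A, F A = ∑ m ∈ Finset.range ((bkpts a T).card - 1), ((patternN a (bkpt a T m) A : ℤ) : ℝ))
    {δ : Fin 8 → ℝ} {ρb : ℝ} (hρ : ∀ k, |phiForm δ k / h28 a k| < ρb) (hρT : 2 * ρb * T * xMax a ^ 2 < 1)
    (hc1 : 2 * ρb * xMax a < 1) (hc2 : 2 * ρb * xMax a < wallDist a T) {k₁ k₂ : Fin 28} (hne : k₁ ≠ k₂)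
    (htie : phiForm δ k₁ / h28 a k₁ = phiForm δ k₂ / h28 a k₂)
    (hsimple : ∀ i j : Fin 28, i ≠ j → phiForm δ i / h28 a i = phiForm δ j / h28 a j →
      (i = k₁ ∧ j = k₂) ∨ (i = k₂ ∧ j = k₁))
    (hm : F (insert k₁ (Finset.univ.filter fun j => phiForm δ k₁ / h28 a k₁ < phiForm δ j / h28 a j)) +
        F (insert k₂ (Finset.univ.filter fun j => phiForm δ k₁ / h28 a k₁ < phiForm δ j / h28 a j)) -
        F (Finset.univ.filter fun j => phiForm δ k₁ / h28 a k₁ < phiForm δ j / h28 a j) -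
        F (insert k₁ (insert k₂ (Finset.univ.filter fun j => phiForm δ k₁ / h28 a k₁ < phiForm δ j / h28 a j))) ≠ 0) :
    ¬DifferentiableAt ℝ (translateIntegral a T) δ := by
  obtain ⟨Δ, hsplit⟩ := exists_split hpos hne
  obtain ⟨m, hmF, -, t₀, ht₀, h⟩ :=
    translateIntegral_kink_of_simple_rate_wall hpos hT hper hF hρ hρT hc1 hc2 hne htie hsimple Δ hsplit
  refine not_differentiableAt_of_kink (κ := (m : ℝ) * (phiForm Δ k₂ / h28 a k₂ - phiForm Δ k₁ / h28 a k₁)) ht₀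
    (mul_ne_zero (by rw [hmF]; exact hm) (by linarith)) h

open scoped Classical in
/-- **THE KINK CRITERION FOR `P` INSIDE THE RATE BALL.** All 28 forms of `a` positive, `T > 0` a period, `F` the canonical period
pattern function; `δ` a translate of the OPEN rate ball with a simple tie at `{k₁, k₂}`. Then **`P` is differentiable at `δ` iff
`m_F(S; k₁, k₂) = 0`** (`S = {j : r_{k₁}(δ) < r_j(δ)}`). -/
theorem differentiableAt_translateIntegral_iff_defect_eq_zero {a : Dir} (hpos : ∀ k, 0 < h28 a k) {T : ℝ} (hT : 0 < T)
    (hper : ∀ k : Fin 28, ∃ z : ℤ, T * h28 a k = z) {F : Finset (Fin 28) → ℝ}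
    (hF : ∀ A, F A = ∑ m ∈ Finset.range ((bkpts a T).card - 1), ((patternN a (bkpt a T m) A : ℤ) : ℝ))
    {δ : Fin 8 → ℝ} {ρb : ℝ} (hρ : ∀ k, |phiForm δ k / h28 a k| < ρb) (hρT : 2 * ρb * T * xMax a ^ 2 < 1)
    (hc1 : 2 * ρb * xMax a < 1) (hc2 : 2 * ρb * xMax a < wallDist a T) {k₁ k₂ : Fin 28} (hne : k₁ ≠ k₂)
    (htie : phiForm δ k₁ / h28 a k₁ = phiForm δ k₂ / h28 a k₂)
    (hsimple : ∀ i j : Fin 28, i ≠ j → phiForm δ i / h28 a i = phiForm δ j / h28 a j →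
      (i = k₁ ∧ j = k₂) ∨ (i = k₂ ∧ j = k₁)) :
    DifferentiableAt ℝ (translateIntegral a T) δ ↔
      F (insert k₁ (Finset.univ.filter fun j => phiForm δ k₁ / h28 a k₁ < phiForm δ j / h28 a j)) +
        F (insert k₂ (Finset.univ.filter fun j => phiForm δ k₁ / h28 a k₁ < phiForm δ j / h28 a j)) -
        F (Finset.univ.filter fun j => phiForm δ k₁ / h28 a k₁ < phiForm δ j / h28 a j) -
        F (insert k₁ (insert k₂ (Finset.univ.filter fun j => phiForm δ k₁ / h28 a k₁ < phiForm δ j / h28 a j))) = 0 := by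
  constructor
  · intro hd
    by_contra hm
    exact not_differentiableAt_translateIntegral_of_defect_ne_zero hpos hT hper hF hρ hρT hc1 hc2 hne htie hsimple hm hd
  · intro hm
    obtain ⟨Δ, hsplit⟩ := exists_split hpos hne
    obtain ⟨δ₀, hgen, hlex⟩ := exists_generic_refines_lex hpos δ Δ
    have href : ∀ k l : Fin 28, phiForm δ k / h28 a k < phiForm δ l / h28 a l →
        phiForm δ₀ k / h28 a k < phiForm δ₀ l / h28 a l := fun k l h => hlex k l (Or.inl h)
    have h12 : phiForm δ₀ k₁ / h28 a k₁ < phiForm δ₀ k₂ / h28 a k₂ := hlex k₁ k₂ (Or.inr ⟨htie, hsplit⟩)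
    have hnear := cuspSlope_eq_greedy_near_of_defect_eq_zero hpos hT hper hF hne htie hsimple hm hgen href h12
    have hball : ∀ᶠ δ' in 𝓝 δ, ∀ k, |phiForm δ' k / h28 a k| ≤ ρb := by
      rw [Filter.eventually_all]
      intro k
      have hc : Continuous fun θ : Fin 8 → ℝ => phiForm θ k / h28 a k := (continuous_phiForm k).div_const _
      filter_upwards [(hc.abs.continuousAt).eventually_lt continuousAt_const (hρ k)] with δ' h
      exact h.le
    -- the chamber functional as a continuous linear map
    set W : Fin 28 → ℝ := fun k => F (Finset.univ.filter fun l => phiForm δ₀ k / h28 a k ≤ phiForm δ₀ l / h28 a l) -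
        F (Finset.univ.filter fun l => phiForm δ₀ k / h28 a k < phiForm δ₀ l / h28 a l) with hW
    let Lₗ : (Fin 8 → ℝ) →ₗ[ℝ] ℝ :=
      { toFun := fun Δ => ∑ k, W k * (phiForm Δ k / h28 a k)
        map_add' := fun Δ Δ' => by
          rw [← Finset.sum_add_distrib]
          exact Finset.sum_congr rfl fun k _ => by rw [phiForm_add]; ring
        map_smul' := fun c Δ => by
          rw [RingHom.id_apply, smul_eq_mul, Finset.mul_sum]
          exact Finset.sum_congr rfl fun k _ => by rw [phiForm_smul]; ring }
    set L : (Fin 8 → ℝ) →L[ℝ] ℝ := LinearMap.toContinuousLinearMap Lₗ with hL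
    have hLapply : ∀ Δ, L Δ = ∑ k, W k * (phiForm Δ k / h28 a k) := fun Δ => rfl
    have hσδ : cuspSlope a T δ = L δ := by rw [hLapply]; exact hnear.self_of_nhds
    have haff : (fun δ' => translateIntegral a T δ + (L δ' - L δ)) =ᶠ[𝓝 δ] translateIntegral a T := by
      filter_upwards [hnear, hball] with δ' hσ' hδ'
      have hP := translateIntegral_sub_eq_cuspSlope_sub_of_rates_le hpos hT hper hδ' (fun k => (hρ k).le) hρT hc1 hc2
      rw [hσ', hσδ, ← hLapply] at hP
      linarith
    have h1 : HasFDerivAt (fun δ' => translateIntegral a T δ + (L δ' - L δ)) L δ :=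
      (L.hasFDerivAt.sub_const (L δ)).const_add (translateIntegral a T δ)
    exact (h1.congr_of_eventuallyEq haff.symm).differentiableAt

end Summit.KontsevichZagierPeriods.Zeta5Search.Barrier.ConeGamma

end
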